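import Summits.QuantumFields.BalabanUV.Beta.GAN24.AliasWeightsSum
import Summits.QuantumFields.BalabanUV.Beta.GAN24.SymbolTaylor

/-!
# `BalabanUV.Beta.GAN24.CapacitanceScalarRate` — binder row G-an2-4 / (CONV-C), road P1-fibre, leaf **P1-Y11s** of
# `GAN24/Formal/LEAVES.md` v2.1 (typer) — PART 1 of 4: lattice-vs-continuum alias WEIGHTS and the relative-bound product engine

NOT IN PRINT; OUR PROOF ATTEMPT.  HONEST FRAMING (cell contract, verbatim): «discharging `BetaPertH` makes Bałaban's UV stability
UNCONDITIONAL — a real constructive-QFT result; it is NOT the continuum limit and NOT the Clay problem.»  HONEST DEPENDENCY (verbatim):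
«continuum YM on T⁴ ⇐ BetaPertH ∧ nine spine estimates (0/9 proved); BetaPertH ⇐ (D1) ∧ (D4) ∧ CAP+tail; G-an2-4 gates asym, D1 and
NE2/3/4.»  [folklore] real analysis (geometric sums, Jordan, `sin` Taylor bounds, finite alias sums); 0 cite, 0 wall binder, no
`def … : Prop`; it discharges NOTHING of (CONV-C)'s K-slot `GAN24.CombesThomas.ConvCK 3 Lc` by itself — it is the Part-B (rate `θ = Lc⁻²`)
bookkeeping for the two SCALAR alias sums `a_κ(p)`, `σ(p)` of the capacitance matrix `Cap = [[diag(a) − (σ/2)δδ♭ᵀ, σδ],[σδ♭ᵀ, 0]]`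
(leaf-02-g4's structure theorem, `GAN24/CapacitanceClosedForm`), consumed by gan24-p1's row P1-L11 `FibreRate` together with rows Y08s/E4 of
`GAN24/Formal/LEAVES.md` v2.1.  NOT `BetaPertH`, NOT continuum, NOT Clay.  Value = kernel bookkeeping leaf toward the K-slot route P1 of binder
row G-an2-4, NOT summit progress.

## The leaf (P1-Y11s = self-row «L11b*», SKELETON-P1 node N17 `blockwise_rate` restricted to the capacitance scalars) in four parts
1. `GAN24/CapacitanceScalarRate` — the normalised one-coordinate alias weight `aw N x = ‖Σ_{t<N} e^{ixt}‖²/N²`, its continuum reference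
   `awInf q = sinc²(q/2)`, the scaled symbol `symN N q = Σ_i N²·4 sin²(q_i/(2N))`, their RELATIVE second-order comparisons on the scaled
   Brillouin zone (R1), and the product engine `mul_rel` / `prod_rel`;
2. `GAN24/CapacitanceScalarRateTerm` — the summands `fA`, `fS` of `ã_κ = a_κ/N^{D+4}`, `σ̃ = σ/N^{D+4}` versus their continuum references
   (`fA_rel`, `fS_rel`: relative rate `(π²/16)(|q|²/N²)·Kc D`), and the ALIAS WINDOWS (`zrep`, integer alias box `boxZ`, nesting in `N`);
3. `GAN24/CapacitanceScalarRateBox` — `aT N p κ = ã_κ^{(N)}(p)`, `sT N p = σ̃^{(N)}(p)` as sums over `(ℤ/N)^D` in leaf P1-L06's `kfine`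
   currency, their alias-box form, and the `N`-uniform continuum alias-sum bounds (R2) `Σ_box Π_i sinc² ≤ 3^D`;
4. `GAN24/CapacitanceScalarRateSum` — (R3) tails and (R4) the TWO-SCALE RATES `aT_rate : |ã_κ^{(N')}(p) − ã_κ^{(N)}(p)| ≤ rateA D/N²`,
   `sT_rate : |σ̃^{(N')} − σ̃^{(N)}| ≤ rateS D·(1 + |p|⁻²)/N²` for all `1 ≤ N ≤ N'`, `p ∈ [−π, π]^D ∖ {0}`.

## What is proved in this part (every `N ≥ 1`, every `D`; constants explicit)
* `aw_mul_symbol` (`aw N x·N²·4sin²(x/2) = 4 sin²(Nx/2)`, from leaf P1-L06's `geomExp_mul_sub_one` BY NAME), `aw_le_one`, `aw_zero`,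
  `awInf_mul_sq`, `awInf_le_one`, `awInf_le_div_sq` (`sinc²(q/2) ≤ 4/q²`);
* **`aw_alias_bounds`** (R1, one coordinate, `|q| ≤ πN`): `awInf q ≤ aw N (q/N) ≤ (π²/4)·awInf q` and
  `aw N (q/N) − awInf q ≤ (π²/48)(q²/N²)·awInf q` — i.e. `0 ≤ y²/sin²y − 1 ≤ (π²/12)y²` on `|y| ≤ π/2` — from leaf P1-L07's
  `abs_sq_mul_four_sin_sq_sub_sq_le` / `sq_mul_four_sin_sq_le_sq` / `jordan_sq_mul_four_sin_sq` BY NAME;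
* **`symN_inv_bounds`** (R1, the inverse symbol, `|q_i| ≤ πN`, `q ≠ 0`): `|q|⁻² ≤ symN⁻¹ ≤ (π²/4)|q|⁻²`,
  `symN⁻¹ − |q|⁻² ≤ (π²/48)(|q|²/N²)|q|⁻²` — leaf P1-L07's `two_sided_sq_mul_lapSym` and King 1986 (4.7) `latticeSymbol_inv_sub_ref_le` BY NAME;
* `mul_rel`, `prod_rel`: the bookkeeping `x' ≤ x ≤ K x'`, `x − x' ≤ e·K·x'` is closed under finite products (`K`'s multiply, `e`'s add).

Unit `b2b-balaban-gan24-formalise-leaf-07` (G-an2-4 formalisation swarm, leaf prover 07, gen 5), 2026-08-19.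
-/

noncomputable section

open Complex Finset
open scoped BigOperators Real

namespace Summit.QuantumFields.BalabanUV.Beta.GAN24.CapacitanceScalarRate

open AliasWeights AliasWeightsSum SymbolTaylor
open Literature.MathematicalPhysics.QuantumFieldTheory.King1986 (latticeSymbol momSq momSq_nonneg
  latticeSymbol_inv_sub_ref_le)

variable {D : ℕ}

/-! ## §1 The normalised one-coordinate alias weight and its continuum reference -/

/-- The NORMALISED one-coordinate block-average weight at fine momentum `x`: `aw N x = ‖Σ_{t<N} e^{ixt}‖²/N²`
(`= sin²(Nx/2)/(N² sin²(x/2))` off `2πℤ`, `= 1` on `2πℤ`; `|s_κ(m)|²/N²` and the factors of `|S(m)|²/N^{2D}` of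
SKELETON-P1 S1b′ at `x = k_{m,κ}`). -/
def aw (N : ℕ) (x : ℝ) : ℝ := ‖∑ t ∈ Finset.range N, cexp (I * x * t)‖ ^ 2 / (N : ℝ) ^ 2

/-- The CONTINUUM reference weight at alias momentum `q = N·x`: `awInf q = sinc²(q/2) = (sin(q/2)/(q/2))²`. -/
def awInf (q : ℝ) : ℝ := Real.sinc (q / 2) ^ 2

/-- [folklore] `0 ≤ aw N x`. -/
theorem aw_nonneg (N : ℕ) (x : ℝ) : 0 ≤ aw N x := by unfold aw; positivity

/-- [folklore] `aw N x ≤ 1` (`‖Σ_{t<N} e^{ixt}‖ ≤ N`). -/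
theorem aw_le_one (N : ℕ) (x : ℝ) : aw N x ≤ 1 := by
  unfold aw
  rcases Nat.eq_zero_or_pos N with h | h
  · subst h; simp
  · have hN : (0 : ℝ) < N := by exact_mod_cast h
    rw [div_le_one (by positivity)]
    have h1 := norm_geomExp_le x N
    exact pow_le_pow_left₀ (norm_nonneg _) h1 2

/-- [folklore] The weight identity `aw N x · (N²·4 sin²(x/2)) = 4 sin²(Nx/2)` (from `G·(e^{ix} − 1) = e^{ixN} − 1`). -/
theorem aw_mul_symbol (N : ℕ) (x : ℝ) :
    aw N x * ((N : ℝ) ^ 2 * (4 * Real.sin (x / 2) ^ 2)) = 4 * Real.sin (N * x / 2) ^ 2 := by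
  rcases Nat.eq_zero_or_pos N with h | h
  · subst h; simp [aw]
  have hN : (0 : ℝ) < N := by exact_mod_cast h
  have hid := geomExp_mul_sub_one (x : ℂ) N
  have hn := congrArg (fun w : ℂ => ‖w‖ ^ 2) hid
  simp only [norm_mul] at hn
  have h1 : ‖cexp (I * x) - 1‖ = |2 * Real.sin (x / 2)| := by
    rw [Complex.norm_exp_I_mul_ofReal_sub_one, Real.norm_eq_abs]
  have h2 : ‖cexp (I * x * N) - 1‖ = |2 * Real.sin (N * x / 2)| := by
    rw [show I * (x : ℂ) * (N : ℂ) = I * ((N * x : ℝ) : ℂ) by push_cast; ring,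
      Complex.norm_exp_I_mul_ofReal_sub_one, Real.norm_eq_abs]
  rw [h1, h2, mul_pow, sq_abs, sq_abs] at hn
  unfold aw
  field_simp
  linear_combination (1 / 4 : ℝ) * hn

/-- [folklore] `awInf q · q² = 4 sin²(q/2)` (all real `q`). -/
theorem awInf_mul_sq (q : ℝ) : awInf q * q ^ 2 = 4 * Real.sin (q / 2) ^ 2 := by
  unfold awInf
  rcases eq_or_ne q 0 with h | h
  · subst h; simp
  · rw [Real.sinc_of_ne_zero (by simpa using h)]
    field_simp
    ring

/-- [folklore] `0 ≤ awInf q`. -/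
theorem awInf_nonneg (q : ℝ) : 0 ≤ awInf q := sq_nonneg _

/-- [folklore] `awInf q ≤ 1` (`|sinc| ≤ 1`). -/
theorem awInf_le_one (q : ℝ) : awInf q ≤ 1 := by
  unfold awInf
  have h := Real.abs_sinc_le_one (q / 2)
  nlinarith [abs_nonneg (Real.sinc (q / 2)), sq_abs (Real.sinc (q / 2))]

/-- [folklore] `awInf 0 = 1`. -/
@[simp] theorem awInf_zero : awInf 0 = 1 := by simp [awInf]

/-- [folklore] Decay of the continuum weight: `awInf q ≤ 4/q²` for `q ≠ 0`. -/
theorem awInf_le_div_sq {q : ℝ} (hq : q ≠ 0) : awInf q ≤ 4 / q ^ 2 := by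
  have h := awInf_mul_sq q
  have hq2 : 0 < q ^ 2 := by positivity
  rw [le_div_iff₀ hq2, h]
  nlinarith [Real.sin_sq_le_one (q / 2)]

/-- [folklore] `aw N 0 = 1` for `N ≥ 1` (the zero alias of a zero momentum coordinate). -/
theorem aw_zero {N : ℕ} (hN : 0 < N) : aw N 0 = 1 := by
  unfold aw
  have hN' : (N : ℝ) ≠ 0 := by exact_mod_cast hN.ne'
  simp [hN']


/-- [folklore] `1 ≤ π²/4`. -/
theorem one_le_pi_sq_div_four : (1 : ℝ) ≤ π ^ 2 / 4 := by
  have := Real.pi_gt_three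
  nlinarith

/-- [folklore] **One-coordinate lattice-vs-continuum weight comparison** at an alias momentum `q` of the scaled Brillouin
zone `|q| ≤ πN` (`N ≥ 1`): `awInf q ≤ aw N (q/N) ≤ (π²/4)·awInf q` and the RELATIVE second-order rate
`aw N (q/N) − awInf q ≤ (π²/48)·(q²/N²)·awInf q` (`y²/sin²y − 1 ≤ (π²/12)y²` on `|y| ≤ π/2`, `y = q/(2N)`; inputs:
`SymbolTaylor.abs_sq_mul_four_sin_sq_sub_sq_le` / `sq_mul_four_sin_sq_le_sq` / `jordan_sq_mul_four_sin_sq` BY NAME). -/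
theorem aw_alias_bounds {N : ℕ} (hN : 0 < N) {q : ℝ} (hq : |q| ≤ π * N) :
    awInf q ≤ aw N (q / N) ∧ aw N (q / N) ≤ π ^ 2 / 4 * awInf q
      ∧ aw N (q / N) - awInf q ≤ π ^ 2 / 48 * (q ^ 2 / (N : ℝ) ^ 2) * awInf q := by
  have hN' : (0 : ℝ) < N := by exact_mod_cast hN
  rcases eq_or_ne q 0 with h0 | h0
  · subst h0
    rw [zero_div, aw_zero hN, awInf_zero]
    refine ⟨le_rfl, by simpa using one_le_pi_sq_div_four, by simp⟩
  set a := aw N (q / N) with ha_def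
  set b := awInf q with hb_def
  set S1 := (N : ℝ) ^ 2 * (4 * Real.sin (q / (2 * N)) ^ 2) with hS1
  set F := 4 * Real.sin (q / 2) ^ 2 with hF
  have ha : a * S1 = F := by
    have h := aw_mul_symbol N (q / N)
    have e1 : q / (N : ℝ) / 2 = q / (2 * N) := by ring
    have e2 : (N : ℝ) * (q / N) / 2 = q / 2 := by field_simp
    rw [e1, e2] at h
    exact h
  have hb : b * q ^ 2 = F := awInf_mul_sq q
  have hq2 : 0 < q ^ 2 := by positivity
  have hS1le : S1 ≤ q ^ 2 := sq_mul_four_sin_sq_le_sq hN'.ne' q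
  have hS1ge : 4 / π ^ 2 * q ^ 2 ≤ S1 := jordan_sq_mul_four_sin_sq hN' hq
  have hS1tay : q ^ 2 - S1 ≤ q ^ 4 / (12 * (N : ℝ) ^ 2) := by
    have h := abs_sq_mul_four_sin_sq_sub_sq_le hN'.ne' q
    have := neg_abs_le (S1 - q ^ 2)
    rw [show q ^ 2 - S1 = -(S1 - q ^ 2) by ring]
    linarith [(abs_le.1 (le_of_eq rfl : |S1 - q ^ 2| ≤ |S1 - q ^ 2|)).1]
  have hπ : 0 < π := Real.pi_pos
  have h4π : 0 < 4 / π ^ 2 * q ^ 2 := by positivity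
  have hS1pos : 0 < S1 := lt_of_lt_of_le h4π hS1ge
  have ha0 : 0 ≤ a := aw_nonneg _ _
  have hb0 : 0 ≤ b := awInf_nonneg _
  -- (i) b ≤ a
  have h1 : b ≤ a := by
    have : b * q ^ 2 ≤ a * q ^ 2 := by rw [hb, ← ha]; exact mul_le_mul_of_nonneg_left hS1le ha0
    exact le_of_mul_le_mul_right this hq2
  -- (ii) a ≤ (π²/4) b
  have h2 : a ≤ π ^ 2 / 4 * b := by
    have h' : a * (4 / π ^ 2 * q ^ 2) ≤ b * q ^ 2 := by rw [hb, ← ha]; exact mul_le_mul_of_nonneg_left hS1ge ha0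
    have h'' : a * (4 / π ^ 2) ≤ b := by
      have : a * (4 / π ^ 2) * q ^ 2 ≤ b * q ^ 2 := by rw [mul_assoc]; exact h'
      exact le_of_mul_le_mul_right this hq2
    have hπ2 : 0 < π ^ 2 := by positivity
    calc a = a * (4 / π ^ 2) * (π ^ 2 / 4) := by field_simp
      _ ≤ b * (π ^ 2 / 4) := mul_le_mul_of_nonneg_right h'' (by positivity)
      _ = π ^ 2 / 4 * b := by ring
  -- (iii) the relative rate
  have h3 : a - b ≤ π ^ 2 / 48 * (q ^ 2 / (N : ℝ) ^ 2) * b := by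
    have key : (a - b) * S1 = b * (q ^ 2 - S1) := by linear_combination ha - hb
    have hnum : b * (q ^ 2 - S1) ≤ b * (q ^ 4 / (12 * (N : ℝ) ^ 2)) := mul_le_mul_of_nonneg_left hS1tay hb0
    -- divide by S1 ≥ (4/π²) q²
    have hab : a - b = b * (q ^ 2 - S1) / S1 := by
      rw [← key]; field_simp
    rw [hab, div_le_iff₀ hS1pos]
    calc b * (q ^ 2 - S1) ≤ b * (q ^ 4 / (12 * (N : ℝ) ^ 2)) := hnum
      _ = π ^ 2 / 48 * (q ^ 2 / (N : ℝ) ^ 2) * b * (4 / π ^ 2 * q ^ 2) := by field_simp; ring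
      _ ≤ π ^ 2 / 48 * (q ^ 2 / (N : ℝ) ^ 2) * b * S1 :=
          mul_le_mul_of_nonneg_left hS1ge (by positivity)
  exact ⟨h1, h2, h3⟩

/-! ### The scaled `D`-dimensional inverse Laplacian symbol -/

/-- The `N`-scaled lattice Laplacian symbol at alias momentum `q`: `symN N q = Σ_i N²·4 sin²(q_i/(2N))`
(`= N²·lapR(q/N) = N²·|∂̂(q/N)|²`; King's `latticeSymbol N⁻¹ 0 q`). -/
def symN (N : ℕ) (q : Fin D → ℝ) : ℝ := ∑ i, (N : ℝ) ^ 2 * (4 * Real.sin (q i / (2 * N)) ^ 2)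

/-- [folklore] `symN N q = N²·lapR (q/N)` (dictionary to `AliasWeightsSum.lapR`). -/
theorem symN_eq_sq_mul_lapR (N : ℕ) (q : Fin D → ℝ) :
    symN N q = (N : ℝ) ^ 2 * lapR (fun i => q i / N) := by
  unfold symN lapR
  rw [Finset.mul_sum]
  refine Finset.sum_congr rfl fun i _ => ?_
  rw [show q i / (N : ℝ) / 2 = q i / (2 * N) by ring]

/-- [folklore] `0 ≤ symN N q`. -/
theorem symN_nonneg (N : ℕ) (q : Fin D → ℝ) : 0 ≤ symN N q :=
  Finset.sum_nonneg fun i _ => by positivity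

/-- [folklore] **Inverse-symbol comparison** on the scaled zone `|q_i| ≤ πN`, `q ≠ 0` (`N ≥ 1`):
`|q|⁻² ≤ symN⁻¹ ≤ (π²/4)|q|⁻²` and the relative rate `symN⁻¹ − |q|⁻² ≤ (π²/48)(|q|²/N²)·|q|⁻²`
(`SymbolTaylor.two_sided_sq_mul_lapSym` and King's (4.7) `latticeSymbol_inv_sub_ref_le` BY NAME). -/
theorem symN_inv_bounds {N : ℕ} (hN : 0 < N) {q : Fin D → ℝ} (hq : ∀ i, |q i| ≤ π * N) (hq0 : 0 < momSq q) :
    (momSq q)⁻¹ ≤ (symN N q)⁻¹ ∧ (symN N q)⁻¹ ≤ π ^ 2 / 4 * (momSq q)⁻¹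
      ∧ (symN N q)⁻¹ - (momSq q)⁻¹ ≤ π ^ 2 / 48 * (momSq q / (N : ℝ) ^ 2) * (momSq q)⁻¹ := by
  have hN' : (0 : ℝ) < N := by exact_mod_cast hN
  have hπ : 0 < π := Real.pi_pos
  have h2 := two_sided_sq_mul_lapSym hN' hq
  have hlow : 4 / π ^ 2 * momSq q ≤ symN N q := h2.1
  have hup : symN N q ≤ momSq q := h2.2
  have h4 : 0 < 4 / π ^ 2 * momSq q := by positivity
  have hSpos : 0 < symN N q := lt_of_lt_of_le h4 hlow
  refine ⟨?_, ?_, ?_⟩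
  · exact inv_anti₀ hSpos hup
  · rw [show π ^ 2 / 4 * (momSq q)⁻¹ = (4 / π ^ 2 * momSq q)⁻¹ by field_simp]
    exact inv_anti₀ h4 hlow
  · have hK := latticeSymbol_inv_sub_ref_le (inv_ne_zero hN'.ne') le_rfl
      (p := q) (fun μ => by
        rw [abs_mul, abs_inv, abs_of_pos hN', inv_mul_le_iff₀ hN']
        simpa [mul_comm] using hq μ) hq0
    rw [← sum_sq_mul_four_sin_sq_eq_latticeSymbol hN'.ne' q, add_zero] at hK
    have e : π ^ 2 / 48 * (momSq q / (N : ℝ) ^ 2) * (momSq q)⁻¹ = π ^ 2 / 48 * ((N : ℝ)⁻¹) ^ 2 := by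
      field_simp
    rw [e]
    exact (le_abs_self _).trans hK

/-! ## §2 Relative bounds are stable under products -/

/-- [folklore] Two factors (a form closed under iteration): if `x' ≤ x ≤ Kx·x'`, `x − x' ≤ ex·Kx·x'` and likewise
for `y`, then `x'y' ≤ xy ≤ (Kx Ky)·x'y'` and `xy − x'y' ≤ (ex + ey)·(Kx Ky)·x'y'`. -/
theorem mul_rel {x x' y y' Kx Ky ex ey : ℝ} (hx' : 0 ≤ x') (hy' : 0 ≤ y') (hKx : 1 ≤ Kx) (hKy : 1 ≤ Ky)
    (hex : 0 ≤ ex) (h1x : x' ≤ x) (h2x : x ≤ Kx * x') (h3x : x - x' ≤ ex * Kx * x')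
    (h1y : y' ≤ y) (h2y : y ≤ Ky * y') (h3y : y - y' ≤ ey * Ky * y') :
    x' * y' ≤ x * y ∧ x * y ≤ Kx * Ky * (x' * y') ∧ x * y - x' * y' ≤ (ex + ey) * (Kx * Ky) * (x' * y') := by
  have hx : 0 ≤ x := hx'.trans h1x
  have hy : 0 ≤ y := hy'.trans h1y
  refine ⟨mul_le_mul h1x h1y hy' hx, ?_, ?_⟩
  · calc x * y ≤ Kx * x' * (Ky * y') := mul_le_mul h2x h2y hy (by positivity)
      _ = Kx * Ky * (x' * y') := by ring
  · have e : x * y - x' * y' = x * (y - y') + (x - x') * y' := by ring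
    rw [e]
    have t1 : x * (y - y') ≤ Kx * x' * (ey * Ky * y') := mul_le_mul h2x h3y (sub_nonneg.2 h1y) (by positivity)
    have t2 : (x - x') * y' ≤ ex * Kx * x' * y' := mul_le_mul_of_nonneg_right h3x hy'
    have t3 : Kx * x' * (ey * Ky * y') + ex * Kx * x' * y' = (ey * Ky + ex) * Kx * (x' * y') := by ring
    have t4 : (ey * Ky + ex) * Kx * (x' * y') ≤ (ex + ey) * (Kx * Ky) * (x' * y') := by
      have : (ey * Ky + ex) * Kx ≤ (ex + ey) * (Kx * Ky) := by
        nlinarith [mul_nonneg (mul_nonneg hex (le_trans zero_le_one hKx)) (sub_nonneg.2 hKy)]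
      exact mul_le_mul_of_nonneg_right this (mul_nonneg hx' hy')
    linarith

/-- [folklore] Finite products: if `b_i ≤ a_i ≤ K·b_i` and `a_i − b_i ≤ e_i·K·b_i` (`b_i, e_i ≥ 0`, `K ≥ 1`) on `s`,
then `Π b ≤ Π a ≤ K^{|s|}·Π b` and `Π a − Π b ≤ (Σ e)·K^{|s|}·Π b`. -/
theorem prod_rel {ι : Type*} (s : Finset ι) {a b e : ι → ℝ} {K : ℝ} (hK : 1 ≤ K)
    (hb : ∀ i ∈ s, 0 ≤ b i) (he : ∀ i ∈ s, 0 ≤ e i) (h1 : ∀ i ∈ s, b i ≤ a i)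
    (h2 : ∀ i ∈ s, a i ≤ K * b i) (h3 : ∀ i ∈ s, a i - b i ≤ e i * K * b i) :
    ∏ i ∈ s, b i ≤ ∏ i ∈ s, a i ∧ ∏ i ∈ s, a i ≤ K ^ s.card * ∏ i ∈ s, b i
      ∧ ∏ i ∈ s, a i - ∏ i ∈ s, b i ≤ (∑ i ∈ s, e i) * K ^ s.card * ∏ i ∈ s, b i := by
  classical
  induction s using Finset.induction_on with
  | empty => simp
  | insert j s hj ih =>
    have hb' : ∀ i ∈ s, 0 ≤ b i := fun i hi => hb i (Finset.mem_insert_of_mem hi)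
    have he' : ∀ i ∈ s, 0 ≤ e i := fun i hi => he i (Finset.mem_insert_of_mem hi)
    obtain ⟨i1, i2, i3⟩ := ih hb' he' (fun i hi => h1 i (Finset.mem_insert_of_mem hi))
      (fun i hi => h2 i (Finset.mem_insert_of_mem hi)) (fun i hi => h3 i (Finset.mem_insert_of_mem hi))
    have hjm : j ∈ insert j s := Finset.mem_insert_self j s
    rw [Finset.prod_insert hj, Finset.prod_insert hj, Finset.sum_insert hj, Finset.card_insert_of_notMem hj,
      pow_succ]
    obtain ⟨m1, m2, m3⟩ := mul_rel (hb j hjm) (Finset.prod_nonneg hb') hK (one_le_pow₀ hK (n := s.card))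
      (he j hjm) (h1 j hjm) (h2 j hjm) (h3 j hjm) i1 i2 i3
    refine ⟨m1, ?_, ?_⟩
    · calc a j * ∏ i ∈ s, a i ≤ K * K ^ s.card * (b j * ∏ i ∈ s, b i) := m2
        _ = K ^ s.card * K * (b j * ∏ i ∈ s, b i) := by ring
    · calc a j * ∏ i ∈ s, a i - b j * ∏ i ∈ s, b i
          ≤ (e j + ∑ i ∈ s, e i) * (K * K ^ s.card) * (b j * ∏ i ∈ s, b i) := m3
        _ = (e j + ∑ i ∈ s, e i) * (K ^ s.card * K) * (b j * ∏ i ∈ s, b i) := by ring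

end Summit.QuantumFields.BalabanUV.Beta.GAN24.CapacitanceScalarRate

end
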